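/-
Origin: expansion seat `planner-pub-hodgecm-pv07-g5-0`, handover #7 2026-08-18T14:49Z, v2 14:55Z (md5 fbdac38fafba0e0d9b6899ace706f1ac; NEW additive leaf; TWO import rewrites by the generic ^import Pv[0-9]+g[0-9]+\. -> import HodgeCM.PerL34. rule: Pv07g5.GenuineSchrodingerSchwartzBox (my #6, RUN 31), Pv13g5.GenuineSchrodingerTensor (pv13-g5 RUN-30 row ddb86af1); land AFTER my #6 and after HodgeCM/PerL34/GenuineSchrodingerTensor.lean is in the tree (RUN 30)) (`HOME/pub-hodgecm-pv07-g5/lean/Pv07g5/GenuineSchrodingerSchwartzTensor.lean`, md5 fbdac38f, 266 lines);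
landed by the gen-8 packager in gate run 31 as `HodgeCM/PerL34/GenuineSchrodingerSchwartzTensor.lean` (import ^import Pv07g5\.GenuineSchrodingerSchwartzBox[ \t]*$→import HodgeCM.PerL34.GenuineSchrodingerSchwartzBox ×1; import ^import Pv13g5\.GenuineSchrodingerTensor[ \t]*$→import HodgeCM.PerL34.GenuineSchrodingerTensor ×1).
-/
/-
Copyright: HodgeCM publication cell (pub-hodgecm), seam S3 (𝓕-side / genuine idelic torus end).  Prover seat
pub-hodgecm-pv07-g5 (DAG-node prover #07, generation 5), file #7; intended final place
`HodgeCM/PerL34/GenuineSchrodingerSchwartzTensor.lean`.  WIP imports: `Pv07g5.GenuineSchrodingerSchwartzBox` ↦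
`HodgeCM.PerL34.GenuineSchrodingerSchwartzBox` (this seat, file #6, RUN 31) and `Pv13g5.GenuineSchrodingerTensor` ↦
`HodgeCM.PerL34.GenuineSchrodingerTensor` (pv13-g5 #2, RUN 30, ddb86af1).  Complete proofs, no new axioms, no new
instances, nothing cited.  Released under the package licence.
-/
import Summits.HodgeConjecture.HodgeCM.PerL34.GenuineSchrodingerSchwartzBox_2
import Summits.HodgeConjecture.HodgeCM.PerL34.GenuineSchrodingerTensor_2

/-!
# `𝒮(X)` is the span of the PURE TENSORS `⊗_v 1_{C_v}` of factorizable boxes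

Kernel meaning, inside the genuine global split Schrödinger model `L²(X)` (`X = Πʳ_{v split} [(L⁺_v)³, 𝒪_v³]`,
pv13-g4 `GenuineSchrodingerModel`), of print's "`𝒮(𝔸³) = ⊗'_v 𝒮(F_v³)`, `φ = ⊗_v φ_v` a pure tensor"
(PerL v5 l. 600; Weil 1964 n° 29 with n° 39 formula (37) — locator per CITED-FACTS KHR-45 —, [MVW] ch. 2 I.3;
orientation only, nothing is cited as a hypothesis) for the SCHWARTZ–BRUHAT space:

* `IsFactorizable.boxVec hC : RVec (locFam L)` — for a factorizable box `C = (C_v)_v` (every `C_v ⊆ (L⁺_v)³`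
  compact open, `C_v = 𝒪_v³` for all but finitely many `v`; file #6) the restricted family of LOCAL Schwartz–Bruhat
  vectors `1_{C_v} ∈ L²((L⁺_v)³, dx_v)`, equal to the reference vector `1_{𝒪_v³}` off the exceptional set;
* `IsFactorizable.tensorIso_tp_boxVec` — **`tensorIso (⊗_v 1_{C_v}) = 1_{∏_v C_v}`**: pv13-g5's isometric embedding
  `tensorIso L : ⊗'_v L²((L⁺_v)³) →ₗᵢ L²(X)` (`GenuineSchrodingerTensor`) takes the pure tensor of the local
  indicator vectors to the indicator vector `indRBox` of the box `rbox L C = {u | ∀ v, u_v ∈ C_v}` (file #6);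
* `Coeff.schwartzBruhat_eq_span_tensorIso_boxVec` — hence, with file #6's `Coeff.schwartzBruhat_eq_span_indRBox`,
  **`𝒮(X) = span {tensorIso (⊗_v 1_{C_v}) : C factorizable}`**, and `Coeff.schwartzBruhat_eq_map_schwartzTensor`:
  `𝒮(X)` is the image under `tensorIso` of `schwartzTensor L := span {⊗_v 1_{C_v}} ⊆ ⊗'_v L²((L⁺_v)³)` — the
  algebraic restricted tensor product of the local Schwartz–Bruhat spaces (spanned by the `1_{C_v}`) with respect
  to the vectors `1_{𝒪_v³}`, read inside the Hilbert restricted tensor product; in particular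
  `Coeff.schwartzBruhat_le_range_tensorIso`;
* `map_repTensor_schwartzTensor` (§4) — **`(⊗'_v ω_v)(k) (schwartzTensor) = schwartzTensor`**: by pv13-g5's
  equivariance `rep_tensorIso`, file #5's `Coeff.schwartzBruhat_stable` and the injectivity of `tensorIso`, the
  Schwartz pure-tensor space is a `U(1)(𝔸_{L⁺})`-submodule of `⊗'_v L²((L⁺_v)³)` identified EQUIVARIANTLY with
  `𝒮(X)` by `tensorIso`.

So the three descriptions of `𝒮(X)` in the package agree: span of indicators of compact open subsets of `X`
(pv07-g5 #5 `Coeff.schwartzBruhat`, the definition) = locally constant compactly supported functions (pv13-g5 #6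
`Coeff.mem_schwartzBruhat_iff`) = image of the pure tensors of local Schwartz–Bruhat vectors (this file).
NO statement of PerL / QW8 / the 2001 programme is cited or used; nothing is posited.
-/

set_option autoImplicit false

noncomputable section

open MeasureTheory MeasureTheory.Measure Set Metric Function Complex Topology Filter
open scoped RestrictedProduct InnerProductSpace NNReal ENNReal

namespace HodgeCM.PerL34.PureTensor.SchrodingerModel

open HodgeCM.PerL34.LocalFactors HodgeCM.PerL34.LocalFactors.DilationModel
open HodgeCM.PerL34.IdelePlaces HodgeCM.PerL34.RestrictedTensor HodgeCM.PerL34.RestrictedTensor.ProdL2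
open NumberField IsDedekindDomain

attribute [local instance] LocalFactors.DilationModel.Adic.nontriviallyNormedField
  LocalFactors.DilationModel.Adic.properSpace

variable {L : Type} [Field L] [NumberField L] [IsCMField L]

/-- set-congruence of `indicatorConstLp` on any measure space (the proof fields are determined by the set) -/
theorem IsFactorizable.indicatorConstLp_eq_of_set_eq {α : Type*} [MeasurableSpace α] {m : Measure α}
    {s t : Set α} (h : s = t) {hs : MeasurableSet s} {ht : MeasurableSet t} {hμs : m s ≠ ∞} {hμt : m t ≠ ∞}
    (c : ℂ) : indicatorConstLp 2 hs hμs c = indicatorConstLp 2 ht hμt c := by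
  subst h; rfl

namespace IsFactorizable

variable {C : ∀ i : SplitIdx L, Set (Coord L i)} (hC : IsFactorizable L C)
include hC

/-- the exceptional places of a factorizable box: `C_v ≠ 𝒪_v³` -/
def excPlaces : Finset (SplitIdx L) := (Filter.eventually_cofinite.1 hC.eventually_eq).toFinset

/-- (Ported verbatim from the HodgeCMPerL package; no docstring in the source.) -/
theorem eq_cube_of_not_mem_exc {i : SplitIdx L} (hi : i ∉ hC.excPlaces) : C i = (cube L i : Set (Coord L i)) := by
  by_contra h
  exact hi ((Filter.eventually_cofinite.1 hC.eventually_eq).mem_toFinset.2 h)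

end IsFactorizable

variable [∀ v : HeightOneSpectrum (𝓞 (maximalRealSubfield L)),
    MeasurableSpace (v.adicCompletion (maximalRealSubfield L))]
  [∀ v : HeightOneSpectrum (𝓞 (maximalRealSubfield L)), BorelSpace (v.adicCompletion (maximalRealSubfield L))]

namespace IsFactorizable

variable {C : ∀ i : SplitIdx L, Set (Coord L i)} (hC : IsFactorizable L C)
include hC

/-! ## §1  The restricted family of local Schwartz–Bruhat vectors `(1_{C_v})_v` -/

/-- the local factor `1_{C_v} ∈ L²((L⁺_v)³, dx_v)` -/
def locVec (i : SplitIdx L) : Lp ℂ 2 (mloc L i) :=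
  indicatorConstLp 2 (hC.isOpen i).measurableSet ((hC.isCompact i).measure_lt_top (μ := mloc L i)).ne (1 : ℂ)

/-- (Ported verbatim from the HodgeCMPerL package; no docstring in the source.) -/
theorem coeFn_locVec (i : SplitIdx L) :
    ⇑(hC.locVec i) =ᵐ[mloc L i] (C i).indicator fun _ => (1 : ℂ) :=
  indicatorConstLp_coeFn

/-- at a place where `C_v = 𝒪_v³` the local factor IS the reference vector `1_{𝒪_v³}` of the restricted
tensor product -/
theorem locVec_eq_e {i : SplitIdx L} (h : C i = (cube L i : Set (Coord L i))) :
    hC.locVec i = (locFam L).e i := by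
  rw [locFam_e]
  unfold locVec ballIndicator
  exact IsFactorizable.indicatorConstLp_eq_of_set_eq (h.trans (coe_cube L i)) 1

/-- **the restricted family `(1_{C_v})_v`** (an element of pv09-g6's `RVec`: equal to `1_{𝒪_v³}` a.a.) -/
def boxVec : RVec (locFam L) :=
  ⟨hC.locVec, by
    filter_upwards [hC.eventually_eq] with i hi
    exact hC.locVec_eq_e hi⟩

/-- (Ported verbatim from the HodgeCMPerL package; no docstring in the source.) -/
@[simp] theorem boxVec_apply (i : SplitIdx L) : hC.boxVec i = hC.locVec i := rfl

/-- (Ported verbatim from the HodgeCMPerL package; no docstring in the source.) -/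
theorem boxVec_eq_of_not_mem_exc {i : SplitIdx L} (hi : i ∉ hC.excPlaces) :
    hC.boxVec i = ballIndicator (mloc L i) 0 1 :=
  (hC.locVec_eq_e (hC.eq_cube_of_not_mem_exc hi)).trans (locFam_e i)

/-! ## §2  `tensorIso (⊗_v 1_{C_v}) = 1_{∏_v C_v}` -/

/-- **the pure tensor of the local indicator vectors is the indicator vector of the box**:
`tensorIso L (⊗_v 1_{C_v}) = 1_{rbox C}` in `L²(X)`.  Proof: both sides are a.e. the function
`u ↦ 1_{cyl_T}(u) ∏_{v ∈ T} 1_{C_v}(u_v)` (`T` the exceptional set), by pv13-g5's a.e. formula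
`coeFn_tensorIso_tp` and the quasi-measure-preservation of the `T`-coordinates on the cylinder
(`RestrictedTensor.ProdL2.quasiMeasurePreserving_apply`). -/
theorem tensorIso_tp_boxVec :
    tensorIso L (tp (locFam L) hC.boxVec) = Coeff.indCO L (rbox L C) hC.isCompact_rbox hC.isOpen_rbox := by
  classical
  set T := hC.excPlaces with hT_def
  have hT : ∀ i ∉ T, hC.boxVec i = ballIndicator (mloc L i) 0 1 := fun i hi => hC.boxVec_eq_of_not_mem_exc hi
  have hloc : ∀ i : T, ∀ᵐ w ∂(μ L).restrict (cylSet (cube L) T),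
      (hC.boxVec i.1 : Coord L i.1 → ℂ) (w i.1) = (C i.1).indicator (fun _ => (1 : ℂ)) (w i.1) := fun i =>
    (quasiMeasurePreserving_apply (μ L) (μ_boxSet L) (mloc L) mloc_cube T i).ae_eq (hC.coeFn_locVec i.1)
  have hall : ∀ᵐ w ∂(μ L), w ∈ cylSet (cube L) T → ∀ i : T,
      (hC.boxVec i.1 : Coord L i.1 → ℂ) (w i.1) = (C i.1).indicator (fun _ => (1 : ℂ)) (w i.1) :=
    (ae_restrict_iff' (isOpen_cylSet T).measurableSet).1 (eventually_all.2 hloc)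
  have hind : ⇑(Coeff.indCO L (rbox L C) hC.isCompact_rbox hC.isOpen_rbox) =ᵐ[μ L]
      (rbox L C).indicator fun _ => (1 : ℂ) := by
    rw [Coeff.indCO]; exact indicatorConstLp_coeFn
  refine Lp.ext_iff.2 ?_
  filter_upwards [coeFn_tensorIso_tp hC.boxVec T hT, hind, hall] with w h1 h2 h3
  rw [h1, h2]
  by_cases hw : w ∈ cylSet (cube L) T
  · rw [indicator_of_mem hw, Finset.prod_congr rfl fun i _ => h3 hw i]
    by_cases hb : w ∈ rbox L C
    · rw [indicator_of_mem hb]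
      exact Finset.prod_eq_one fun i _ => by rw [indicator_of_mem (hb i.1)]
    · rw [indicator_of_notMem hb]
      obtain ⟨i, hi⟩ : ∃ i, w i ∉ C i := by
        by_contra h
        exact hb fun i => not_not.1 fun hi => h ⟨i, hi⟩
      have hiT : i ∈ T := by
        by_contra hiT
        refine hi ?_
        rw [hC.eq_cube_of_not_mem_exc hiT]
        exact (mem_cylSet_iff T w).1 hw i hiT
      exact Finset.prod_eq_zero (Finset.mem_univ (⟨i, hiT⟩ : T)) (by rw [indicator_of_notMem hi])
  · rw [indicator_of_notMem hw, indicator_of_notMem]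
    intro hb
    refine hw ((mem_cylSet_iff T w).2 fun j hj => ?_)
    rw [← hC.eq_cube_of_not_mem_exc hj]
    exact hb j

end IsFactorizable

namespace Coeff

/-- file #6's box indicator IS the pure tensor: `indRBox C = tensorIso (⊗_v 1_{C_v})` -/
theorem indRBox_eq_tensorIso_tp (C : {C : ∀ i : SplitIdx L, Set (Coord L i) // IsFactorizable L C}) :
    indRBox L C = tensorIso L (tp (locFam L) C.2.boxVec) :=
  C.2.tensorIso_tp_boxVec.symm

/-- **`𝒮(X) = span { tensorIso (⊗_v 1_{C_v}) : C a factorizable box }`** -/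
theorem schwartzBruhat_eq_span_tensorIso_boxVec :
    schwartzBruhat L = Submodule.span ℂ (Set.range
      fun C : {C : ∀ i : SplitIdx L, Set (Coord L i) // IsFactorizable L C} =>
        tensorIso L (tp (locFam L) C.2.boxVec)) := by
  have h : indRBox L = fun C : {C : ∀ i : SplitIdx L, Set (Coord L i) // IsFactorizable L C} =>
      tensorIso L (tp (locFam L) C.2.boxVec) := funext fun C => indRBox_eq_tensorIso_tp C
  rw [schwartzBruhat_eq_span_indRBox, h]

/-- so `𝒮(X)` lies in the range of the isometric embedding `⊗'_v L²((L⁺_v)³) ↪ L²(X)` -/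
theorem schwartzBruhat_le_range_tensorIso :
    schwartzBruhat L ≤ LinearMap.range (tensorIso L).toLinearMap := by
  rw [schwartzBruhat_eq_span_tensorIso_boxVec]
  refine Submodule.span_le.2 ?_
  rintro _ ⟨C, rfl⟩
  exact ⟨tp (locFam L) C.2.boxVec, rfl⟩

end Coeff

variable (L) in
/-- **the Schwartz–Bruhat pure-tensor space** `span {⊗_v 1_{C_v} : C factorizable} ⊆ ⊗'_v L²((L⁺_v)³)`: the
algebraic restricted tensor product of the local Schwartz–Bruhat spaces (each spanned by the indicator vectors of
the compact open subsets of `(L⁺_v)³`) with respect to the vectors `1_{𝒪_v³}`, inside the Hilbert one -/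
def schwartzTensor : Submodule ℂ (RestrictedTensor.Space (locFam L)) :=
  Submodule.span ℂ (Set.range
    fun C : {C : ∀ i : SplitIdx L, Set (Coord L i) // IsFactorizable L C} => tp (locFam L) C.2.boxVec)

/-- (Ported verbatim from the HodgeCMPerL package; no docstring in the source.) -/
theorem tp_boxVec_mem_schwartzTensor (C : {C : ∀ i : SplitIdx L, Set (Coord L i) // IsFactorizable L C}) :
    tp (locFam L) C.2.boxVec ∈ schwartzTensor L :=
  Submodule.subset_span ⟨C, rfl⟩

/-- **`𝒮(X) = tensorIso (⊗'_v 𝒮((L⁺_v)³))`**: the global Schwartz–Bruhat space is the image of the Schwartz–Bruhat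
pure-tensor space under pv13-g5's isometric embedding -/
theorem Coeff.schwartzBruhat_eq_map_schwartzTensor :
    Coeff.schwartzBruhat L = (schwartzTensor L).map (tensorIso L).toLinearMap := by
  rw [schwartzTensor, Submodule.map_span, Coeff.schwartzBruhat_eq_span_tensorIso_boxVec, ← Set.range_comp]
  rfl

/-- and `tensorIso` maps the Schwartz–Bruhat pure-tensor space INTO `𝒮(X)` -/
theorem tensorIso_mem_schwartzBruhat_of_mem_schwartzTensor {z : RestrictedTensor.Space (locFam L)}
    (hz : z ∈ schwartzTensor L) : tensorIso L z ∈ Coeff.schwartzBruhat L := by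
  rw [Coeff.schwartzBruhat_eq_map_schwartzTensor]
  exact Submodule.mem_map_of_mem hz

/-! ## §4  Equivariance: the Schwartz pure-tensor space is `⊗'_v ω_v`-stable

pv13-g5's `rep_tensorIso` (`ω(k) ∘ tensorIso = tensorIso ∘ (⊗'_v ω_v)(k)`, `ω = rep L 1` the genuine global
representation, `⊗'_v ω_v = repTensor L` pv09-g6's restricted tensor product of the local dilation representations),
file #5's `Coeff.schwartzBruhat_stable` (`𝒮(X)` is `ω`-stable) and the injectivity of the isometry `tensorIso`
give: `(⊗'_v ω_v)(k)` maps `schwartzTensor L` onto itself — the Schwartz pure-tensor space is a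
`U(1)(𝔸_{L⁺})`-submodule of `⊗'_v L²((L⁺_v)³)`, identified with `𝒮(X) ⊆ L²(X)` equivariantly by `tensorIso`. -/

section Equivariance

open HodgeCM.PerL34.IdelicTorusModel HodgeCM.PerL34.IdelicTorusModel.Genuine

variable [DecidableEq (Place (maximalRealSubfield L))]

/-- `(⊗'_v ω_v)(k)` maps the Schwartz pure-tensor space INTO itself -/
theorem repTensor_mem_schwartzTensor (k : Model L) {z : RestrictedTensor.Space (locFam L)}
    (hz : z ∈ schwartzTensor L) : repTensor L k z ∈ schwartzTensor L := by
  have h1 : tensorIso L (repTensor L k z) ∈ Coeff.schwartzBruhat L := by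
    rw [← rep_tensorIso]
    exact Coeff.schwartzBruhat_stable 1 k _ (tensorIso_mem_schwartzBruhat_of_mem_schwartzTensor hz)
  rw [Coeff.schwartzBruhat_eq_map_schwartzTensor] at h1
  obtain ⟨z', hz', h⟩ := Submodule.mem_map.1 h1
  have h' : z' = repTensor L k z := (tensorIso L).injective (by simpa only [LinearIsometry.coe_toLinearMap] using h)
  exact h' ▸ hz'

/-- **`(⊗'_v ω_v)(k) (schwartzTensor) = schwartzTensor`** for every `k ∈ U(1)(𝔸_{L⁺})` -/
theorem map_repTensor_schwartzTensor (k : Model L) :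
    (schwartzTensor L).map (repTensor L k).toLinearEquiv.toLinearMap = schwartzTensor L := by
  refine le_antisymm ?_ fun z hz => ?_
  · rintro _ ⟨z, hz, rfl⟩
    exact repTensor_mem_schwartzTensor k hz
  · refine ⟨repTensor L k⁻¹ z, repTensor_mem_schwartzTensor k⁻¹ hz, ?_⟩
    have h1 : repTensor L k * repTensor L k⁻¹ = 1 := by rw [← map_mul, mul_inv_cancel, map_one]
    have h2 := congrArg (fun T : RestrictedTensor.Space (locFam L) ≃ₗᵢ[ℂ] RestrictedTensor.Space (locFam L) => T z) h1
    show repTensor L k (repTensor L k⁻¹ z) = z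
    simpa only [LinearIsometryEquiv.coe_mul, Function.comp_apply, LinearIsometryEquiv.coe_one, id_eq] using h2

/-- and `tensorIso` intertwines on it: `ω(k) (tensorIso z) = tensorIso ((⊗'_v ω_v)(k) z) ∈ 𝒮(X)` for `z` a
Schwartz pure-tensor vector -/
theorem rep_tensorIso_mem_schwartzBruhat (k : Model L) {z : RestrictedTensor.Space (locFam L)}
    (hz : z ∈ schwartzTensor L) : rep L 1 k (tensorIso L z) ∈ Coeff.schwartzBruhat L := by
  rw [rep_tensorIso]
  exact tensorIso_mem_schwartzBruhat_of_mem_schwartzTensor (repTensor_mem_schwartzTensor k hz)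

end Equivariance

end HodgeCM.PerL34.PureTensor.SchrodingerModel

end
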